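import Literature.AlgebraicGeometry.GroupSchemes.PermutationActionProjectiveSpace
import Literature.AlgebraicGeometry.GroupActions.EquivariantPolynomialPresentation
import Literature.AlgebraicGeometry.RelativeSpec.FiniteGroupQuotient
import Literature.AlgebraicGeometry.Motives.BaseChangeProofs
import HarnessLib

/-!
# Equivariant immersion of an affine scheme of finite type with a finite group action into `ℙⁿ_K`

Topic `Literature/AlgebraicGeometry/Resolution` (companion of `EquivariantProjectiveCompletion`: there the
completion is built by normalisation and carries an action over a FIXED projective space; here the group acts
on the ambient `ℙⁿ_K` itself, linearly). ONE THEOREM, no definition, no named fact; the `attribute [local instance]`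
lines are those of `Motives/VarietiesProjectiveSpaceProofs` (to speak about `Proj K[x₀, …, xₙ]` and its chart
algebra).

**Statement** (`exists_equivariant_immersion_proj`). Let `K` be a field, `Y` an affine `K`-scheme of finite type
and `ρ` an action of a FINITE group `G` on `Y` over `K` (the tree's `RelativeSpec.ActionOver`). Then for some `n`
there are an immersion `f : Y ↪ ℙⁿ_K` over `K` and a homomorphism `ρP : G → Aut_K(ℙⁿ_K)` (permutation matrices)
with `ρ(g) ≫ f = f ≫ ρP(g)` for all `g`.

**Proof.** `Γ(Y)` has a presentation `θ : K[y₁, …, yₙ] ↠ Γ(Y)` by a `G`-stable family of generators which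
`G` permutes, `Γ(ρ g) ∘ θ = θ ∘ rename (π g)⁻¹` (`GroupActions.exists_equivariant_presentation` — the translates
of any finite generating family; Mumford AV §7); this is a closed immersion `Y ↪ 𝔸ⁿ_K = D₊(x₀) ⊆ ℙⁿ_K`
(Görtz–Wedhorn §(12.15), as in `ChowLemmaRing.exists_immersion_projOver`), and the permutations `π g` of
`x₁, …, xₙ` act on `ℙⁿ_K` over `K` preserving `D₊(x₀)`, where they rename the affine coordinates
(`GroupSchemes.ProjLinAction.exists_permAction_proj`); the two renamings agree, whence the equivariance.

Use: brick «B3» of the Kollár-free deck family of route `HodgeConjecture/Q8SymplecticPowers` (crux K1Q,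
stmt-HodgeConjecture-24190): with the reduced closure of `f(Y)` (`StableReducedSubschemeAction`) and the
equivariant strong resolution in `ℙⁿ_K` (`EquivariantStrongProjectiveResolution`) it yields an equivariant
regular projective completion of a regular affine `G`-variety (`EquivariantRegularProjectiveCompletion`).
Route-agnostic; nothing here bears on HC.

## References

* [MumfordAV1970] D. Mumford, Abelian Varieties (1970), §7 (proof of the Theorem on quotients, p. 66).
* [GortzWedhorn2020] U. Görtz, T. Wedhorn, Algebraic Geometry I, 2nd ed. (2020), §(12.15) p. 440, (11.15.1).
* [Hartshorne1977] R. Hartshorne, Algebraic Geometry (1977), II Example 7.1.1.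
-/

noncomputable section

universe u

open CategoryTheory AlgebraicGeometry MvPolynomial HomogeneousLocalization

attribute [local instance] MvPolynomial.gradedAlgebra
  Literature.AlgebraicGeometry.Motives.ProjBaseChange.algebraBase
  Literature.AlgebraicGeometry.Motives.ProjBaseChange.isScalarTower_localization

namespace Literature.AlgebraicGeometry.Resolution

open Literature.AlgebraicGeometry.Motives Literature.AlgebraicGeometry.RelativeSpec
  Literature.AlgebraicGeometry.GroupSchemes.ProjLinAction Literature.AlgebraicGeometry.GroupActions

/-- **Equivariant quasi-projectivity of affine `G`-schemes of finite type, `G` finite.** Let `K` be a field,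
`Y` an affine `K`-scheme of finite type (`q : Y → Spec K`) and `ρ` an action of a finite group `G` on `Y` over `K`.
Then for some `n` there are an IMMERSION `f : Y ↪ ℙⁿ_K = Proj K[x₀, …, xₙ]` over `K` and a homomorphism
`ρP : G → Aut(ℙⁿ_K)` into automorphisms over `K` (permutation matrices, `GroupSchemes.ProjLinAction`) for which
`f` is EQUIVARIANT: `ρ(g) ≫ f = f ≫ ρP(g)`. Construction: a presentation `Γ(Y) = K[y₁, …, yₙ]/I` by a `G`-stable
family of generators permuted by `G` (`GroupActions.exists_equivariant_presentation`), the closed immersion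
`Y ↪ 𝔸ⁿ_K = D₊(x₀)` it defines (Görtz–Wedhorn §(12.15)), and the permutation action on `ℙⁿ_K` fixing `x₀`
(`exists_permAction_proj`), which acts on `D₊(x₀)` by the same renaming. [cite: MumfordAV1970, §7 (proof of the Theorem, p. 66)]
[cite: GortzWedhorn2020, §(12.15) p. 440] -/
theorem exists_equivariant_immersion_proj {K : Type u} [Field K] {Y : Scheme.{u}} [IsAffine Y]
    (q : Y ⟶ Spec (.of K)) [LocallyOfFiniteType q] {G : Type*} [Group G] [Finite G] (ρ : ActionOver q G) :
    ∃ (n : ℕ) (f : Y ⟶ Proj (homogeneousSubmodule (Fin (n + 1)) K))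
      (ρP : G →* Aut (Proj (homogeneousSubmodule (Fin (n + 1)) K))),
      IsImmersion f ∧ f ≫ ProjBaseChange.projToSpec (Fin (n + 1)) K = q ∧
      (∀ g, (ρP g).hom ≫ ProjBaseChange.projToSpec (Fin (n + 1)) K = ProjBaseChange.projToSpec (Fin (n + 1)) K) ∧
      ∀ g, (ρ.aut g).hom ≫ f = f ≫ (ρP g).hom := by
  classical
  -- ### the coordinate ring `R = Γ(Y)` as a `K`-algebra of finite type with the contravariant action `β`
  let ψ : K →+* Γ(Y, ⊤) := q.appTop.hom.comp (Scheme.ΓSpecIso (.of K)).inv.hom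
  have hψ : ψ.FiniteType := by
    have h1 : q.appTop.hom.FiniteType :=
      (HasRingHomProperty.iff_of_isAffine (P := @LocallyOfFiniteType)).mp ‹_›
    refine h1.comp (RingHom.FiniteType.of_surjective _ ?_)
    exact (Scheme.ΓSpecIso (.of K)).symm.commRingCatIsoToRingEquiv.surjective
  let β : G → (Γ(Y, ⊤) →+* Γ(Y, ⊤)) := fun g => (ρ.aut g).hom.appTop.hom
  have hβq : ∀ g, (β g).comp q.appTop.hom = q.appTop.hom := fun g => by
    have h := congrArg Scheme.Hom.appTop (ρ.aut_comp g)
    rw [Scheme.Hom.comp_appTop] at h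
    exact congrArg CommRingCat.Hom.hom h
  have hβK : ∀ g, (β g).comp ψ = ψ := fun g => by
    change ((β g).comp q.appTop.hom).comp _ = _
    rw [hβq]
  have hβmul : ∀ g h, β (g * h) = (β h).comp (β g) := fun g h => by
    change ((ρ.aut (g * h)).hom.appTop).hom = _
    rw [map_mul, Aut.Aut_mul_def, Iso.trans_hom, Scheme.Hom.comp_appTop]
    rfl
  have hβone : β 1 = RingHom.id _ := by
    change ((ρ.aut 1).hom.appTop).hom = _
    rw [map_one]
    change ((𝟙 Y : Y ⟶ Y).appTop).hom = _
    rw [Scheme.Hom.id_appTop]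
    rfl
  obtain ⟨n, θ, π, hθ, hθC, hθβ⟩ := exists_equivariant_presentation ψ hψ β hβK hβmul hβone
  obtain ⟨ρP, hρPK, hρPchart⟩ := exists_permAction_proj K n
  -- ### the immersion `Y ≅ Spec R ↪ Spec (K[x]_{x₀})₀ = D₊(x₀) ⊆ ℙⁿ_K`
  let e := ProjectiveSpace.chartAlgEquiv K (0 : Fin (n + 1))
  let φ : Away (homogeneousSubmodule (Fin (n + 1)) K) (X 0) →+* Γ(Y, ⊤) := θ.comp e.toAlgHom.toRingHom
  have hφ : Function.Surjective φ := hθ.comp e.surjective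
  have hφψ : φ.comp (algebraMap K _) = ψ := by
    ext c
    change θ (e (algebraMap K _ c)) = ψ c
    rw [e.commutes, MvPolynomial.algebraMap_eq, ← RingHom.comp_apply, hθC]
  haveI : IsClosedImmersion (Spec.map (CommRingCat.ofHom φ)) := IsClosedImmersion.spec_of_surjective _ hφ
  let f : Y ⟶ Proj (homogeneousSubmodule (Fin (n + 1)) K) :=
    Y.isoSpec.hom ≫ Spec.map (CommRingCat.ofHom φ) ≫
      Proj.awayι (homogeneousSubmodule (Fin (n + 1)) K) (X 0) (ProjectiveSpace.X_mem 0) zero_lt_one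
  have hf : IsImmersion f := inferInstance
  refine ⟨n, f, ρP.comp π, hf, ?_, fun g => ?_, fun g => ?_⟩
  · -- over `K`
    change (_ ≫ _ ≫ _) ≫ ProjBaseChange.projToSpec (Fin (n + 1)) K = q
    rw [Category.assoc, Category.assoc, ProjBaseChange.awayι_projToSpec, ← Spec.map_comp,
      ← CommRingCat.ofHom_comp, hφψ]
    have hψ' : CommRingCat.ofHom ψ = (Scheme.ΓSpecIso (.of K)).inv ≫ q.appTop := rfl
    rw [hψ', Spec.map_comp, Scheme.isoSpec_hom, ← Scheme.toSpecΓ_naturality_assoc, ← SpecMap_ΓSpecIso_hom,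
      ← Spec.map_comp, Iso.inv_hom_id, Spec.map_id, Category.comp_id]
  · -- `ρP` is over `K`
    change (ρP (π g)).hom ≫ Proj.toSpecZero _ ≫ _ = Proj.toSpecZero _ ≫ _
    rw [← Category.assoc, hρPK]
  · -- equivariance: both sides are `Y ≅ Spec R → Spec (K[x]_{x₀})₀ ↪ ℙⁿ` through ONE ring map
    have key : (β g).comp φ = φ.comp ((e.symm.toAlgHom.comp ((rename ⇑(π g)⁻¹).comp e.toAlgHom)).toRingHom) := by
      rw [← RingHom.comp_assoc, hθβ]
      ext x
      change θ (rename _ (e x)) = θ (e (e.symm (rename _ (e x))))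
      rw [AlgEquiv.apply_symm_apply]
    change (ρ.aut g).hom ≫ Y.isoSpec.hom ≫ Spec.map (CommRingCat.ofHom φ) ≫ _ =
      (Y.isoSpec.hom ≫ Spec.map (CommRingCat.ofHom φ) ≫ _) ≫ ((ρP.comp π) g).hom
    rw [MonoidHom.comp_apply, Category.assoc, Category.assoc, hρPchart (π g), ← Spec.map_comp_assoc,
      ← CommRingCat.ofHom_comp, ← key, Scheme.isoSpec_hom, Scheme.toSpecΓ_naturality_assoc, ← Spec.map_comp_assoc]
    rfl

end Literature.AlgebraicGeometry.Resolution

end
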